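import Summits.NavierStokesRegularity.NavierStokesRegularity.Theorems.StrainDoorsThreshold
import Literature.Analysis.FluidPDE.ClassicalSolutionGlue
import Literature.Analysis.FluidPDE.TaoEnstrophyLocalisation
import Literature.Analysis.FluidPDE.NSVorticity
import HarnessLib

/-!
# StrainDoorsThresholdLinear — S37 «StrainDoors» (nsreg-p1 g31, ROUND-35) plate E2_S-lin «StrainThresholdLinear»,
# δ-unfolded (texts of record `r35/Sketch37.lean` sha16 265cb074f1d98fd0, l.238; the by-name one-liner
# `strainThresholdLinear_holds : StrainThresholdLinear := strainThresholdLinear` follows P0-37)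

The Navier–Stokes instance of the LEAD's abstract first-touch device
`StrainDoorsThreshold.rayleigh_le_supersolution_of_argmax_growth` (p655218): time shift `[t₁,t₂] ↦ [0,t₂−t₁]`,
`W(s,x) = ∇u(t₁+s,x)` jointly smooth by `smooth_velocity.fderiv_slice`, uniform decay of `∇u` on the slab as a
HYPOTHESIS (plate D_S «GradientUniformDecay»), and the identification of the device's one-sided time derivative
(within `[0,t₂−t₁]`, operator-valued, applied to `ē`) with the text's `strainRate` (within `[0,T)`, of the field
`(s,y) ↦ ∇u(s,y)ē`) via `derivWithin_subset` + `timeDerivWithin_comp_add_right` + `HasDerivWithinAt.clm_apply`.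

* `strainThresholdLinear` — the δ-unfolded statement of `StrainThresholdLinear`, proved.

HONEST FRAME / WHAT THIS IS NOT: an engine plate of regularity CRITERIA about hypothetical blow-up (S-door lane,
LEAD ns-s30-p1 g3; `--supports stmt-NavierStokesRegularity-0056 --as helper`); item 0056 `NoTypeII` and NS
regularity are NOT proved; no Literature fact is taken as a hypothesis; nothing here is a route or a summit
statement.
-/

noncomputable section

open Set Function Filter Metric MeasureTheory
open scoped RealInnerProductSpace Topology ContDiff

set_option linter.dupNamespace false

namespace Summit.NavierStokesRegularity.NavierStokesRegularity.Theorems.ArgmaxDoors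

open Literature.Analysis Literature.Analysis.FluidPDE

set_option maxHeartbeats 800000 in
-- time shift + derivative bookkeeping
/-- **Plate E2_S-lin «StrainThresholdLinear» (δ-unfolded text of `r35/Sketch37.lean` l.238).** In the frame on a
slab `[t₁,t₂] ⊂ [0,T)` with `∇u → 0` uniformly at spatial infinity on the slab (hypothesis, = plate D_S), a barrier
`B > 0`, `B' ≥ φB` within `[t₁,t₂]`; if at every `t ∈ (t₁,t₂]` and every strain argmax `(x̄,ē)` above the barrier
the one-sided rate `⟪∂ₜ(∇u ē)(x̄), ē⟫` (within `[0,T)`) is `≤ φ(t)⟪∇u(x̄)ē,ē⟫`, then `⟪∇u(t₁,·)e,e⟫ ≤ B(t₁)`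
propagates along the slab. Proof: `rayleigh_le_supersolution_of_argmax_growth` (p655218) for
`W(s,x) = ∇u(t₁+s,x)` on `[0,t₂−t₁]`; the one-sided derivative within `[t₁,t₂]` of `s ↦ ∇u(s,x̄)ē` agrees with the
one within `[0,T)` because the field is differentiable within the larger set. [folklore] -/
theorem strainThresholdLinear :
    ∀ (ν T t₁ t₂ : ℝ), 0 < ν → 0 ≤ t₁ → t₁ < t₂ → t₂ < T →
    ∀ (u : ℝ → (EuclideanSpace ℝ (Fin 3)) → (EuclideanSpace ℝ (Fin 3)))
      (p : ℝ → (EuclideanSpace ℝ (Fin 3)) → ℝ),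
      IsClassicalNSSolutionOn (Ico 0 T) ν 0 u p →
      (∀ T'' < T, HasBoundedSobolevNormsOn (Icc 0 T'') u) →
      (∀ η : ℝ, 0 < η → ∃ R : ℝ, ∀ t ∈ Icc t₁ t₂, ∀ x : EuclideanSpace ℝ (Fin 3),
          R ≤ ‖x‖ → ‖fderiv ℝ (u t) x‖ ≤ η) →
      ∀ (B B' φ : ℝ → ℝ), ContinuousOn B (Icc t₁ t₂) → (∀ t ∈ Icc t₁ t₂, 0 < B t) →
        (∀ t ∈ Icc t₁ t₂, HasDerivWithinAt B (B' t) (Icc t₁ t₂) t) →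
        (∀ t ∈ Icc t₁ t₂, φ t * B t ≤ B' t) →
        (∀ t ∈ Ioc t₁ t₂, ∀ (x e : EuclideanSpace ℝ (Fin 3)),
          (‖e‖ = 1 ∧ ∀ (y e' : EuclideanSpace ℝ (Fin 3)), ‖e'‖ = 1 →
            ⟪fderiv ℝ (u t) y e', e'⟫ ≤ ⟪fderiv ℝ (u t) x e, e⟫) →
          B t < ⟪fderiv ℝ (u t) x e, e⟫ →
          ⟪timeDerivWithin (Ico 0 T) (fun s y => fderiv ℝ (u s) y e) t x, e⟫ ≤
            φ t * ⟪fderiv ℝ (u t) x e, e⟫) →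
        (∀ (x e : EuclideanSpace ℝ (Fin 3)), ‖e‖ = 1 → ⟪fderiv ℝ (u t₁) x e, e⟫ ≤ B t₁) →
        ∀ t ∈ Icc t₁ t₂, ∀ (x e : EuclideanSpace ℝ (Fin 3)), ‖e‖ = 1 → ⟪fderiv ℝ (u t) x e, e⟫ ≤ B t := by
  intro ν T t₁ t₂ hν ht₁ h12 ht₂ u p hsol hreg hdec B B' φ hBc hBpos hBd hsuper hrate hinit t ht x e he
  set L : ℝ := t₂ - t₁ with hLdef
  have hL : 0 < L := by rw [hLdef]; linarith
  have hUT : UniqueDiffOn ℝ (Ico (0 : ℝ) T) := uniqueDiffOn_Ico 0 T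
  have hUL : UniqueDiffOn ℝ (Icc (0 : ℝ) L) := uniqueDiffOn_Icc hL
  -- the gradient field and its shift
  set G : ℝ → (EuclideanSpace ℝ (Fin 3)) → ((EuclideanSpace ℝ (Fin 3)) →L[ℝ] (EuclideanSpace ℝ (Fin 3))) :=
    fun s y => fderiv ℝ (u s) y with hG
  have hGs : IsSmoothSpaceTimeOn (Ico 0 T) G := hsol.smooth_velocity.fderiv_slice hUT
  have hmem : ∀ s ∈ Icc (0 : ℝ) L, s + t₁ ∈ Icc t₁ t₂ := fun s hs =>
    ⟨by linarith [hs.1], by rw [hLdef] at hs; linarith [hs.2]⟩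
  have hmemT : ∀ s ∈ Icc (0 : ℝ) L, s + t₁ ∈ Ico 0 T := fun s hs =>
    ⟨by linarith [hs.1], by rw [hLdef] at hs; linarith [hs.2]⟩
  have hsub : Icc (0 : ℝ) L ⊆ (· + t₁) ⁻¹' Ico 0 T := fun s hs => hmemT s hs
  set W : ℝ → (EuclideanSpace ℝ (Fin 3)) → ((EuclideanSpace ℝ (Fin 3)) →L[ℝ] (EuclideanSpace ℝ (Fin 3))) :=
    fun s y => G (s + t₁) y with hW
  have hWs : IsSmoothSpaceTimeOn (Icc 0 L) W := (hGs.comp_add_right t₁).mono hsub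
  have hunif : ∀ η : ℝ, 0 < η → ∃ R : ℝ, ∀ s ∈ Icc 0 L, ∀ y : EuclideanSpace ℝ (Fin 3),
      R ≤ ‖y‖ → ‖W s y‖ ≤ η := by
    intro η hη
    obtain ⟨R, hR⟩ := hdec η hη
    exact ⟨R, fun s hs y hy => hR (s + t₁) (hmem s hs) y hy⟩
  -- the shifted barrier
  have hBc' : ContinuousOn (fun s => B (s + t₁)) (Icc 0 L) :=
    hBc.comp (continuous_add_const t₁).continuousOn hmem
  have hBpos' : ∀ s ∈ Icc 0 L, 0 < B (s + t₁) := fun s hs => hBpos _ (hmem s hs)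
  have hBd' : ∀ s ∈ Icc 0 L, HasDerivWithinAt (fun r => B (r + t₁)) (B' (s + t₁)) (Icc 0 L) s := by
    intro s hs
    have h1 : HasDerivWithinAt (fun r : ℝ => r + t₁) 1 (Icc 0 L) s := (hasDerivWithinAt_id s _).add_const t₁
    have h := (hBd (s + t₁) (hmem s hs)).comp s h1 (fun r hr => hmem r hr)
    rw [mul_one] at h
    exact h
  have hsuper' : ∀ s ∈ Icc 0 L, φ (s + t₁) * B (s + t₁) ≤ B' (s + t₁) := fun s hs => hsuper _ (hmem s hs)
  -- the time derivative of the shifted operator field, applied to `e₀`, is the frame's one-sided rate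
  have hkey : ∀ s ∈ Icc 0 L, ∀ (x₀ e₀ : EuclideanSpace ℝ (Fin 3)),
      timeDerivWithin (Icc 0 L) W s x₀ e₀ =
        timeDerivWithin (Ico 0 T) (fun r y => fderiv ℝ (u r) y e₀) (s + t₁) x₀ := by
    intro s hs x₀ e₀
    have hr : s + t₁ ∈ Ico 0 T := hmemT s hs
    set D := timeDerivWithin (Ico 0 T) G (s + t₁) x₀ with hD
    have hF : HasDerivWithinAt (fun r => G r x₀) D (Ico 0 T) (s + t₁) := by
      rw [hD, timeDerivWithin_apply]
      exact (hGs.differentiableWithinAt_time hr x₀).hasDerivWithinAt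
    -- right side
    have h1 : timeDerivWithin (Ico 0 T) (fun r y => fderiv ℝ (u r) y e₀) (s + t₁) x₀ = D e₀ := by
      rw [timeDerivWithin_apply]
      have h := hF.clm_apply (hasDerivWithinAt_const (s + t₁) (Ico 0 T) e₀)
      have h' : HasDerivWithinAt (fun r => G r x₀ e₀) (D e₀) (Ico 0 T) (s + t₁) := by simpa using h
      exact h'.derivWithin (hUT _ hr)
    -- left side
    have h2 : timeDerivWithin (Icc 0 L) W s x₀ = D := by
      have e1 : timeDerivWithin (Icc 0 L) W s x₀ = timeDerivWithin ((· + t₁) ⁻¹' Ico 0 T) W s x₀ := by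
        simp only [timeDerivWithin_apply]
        exact derivWithin_subset hsub (hUL s hs)
          ((hGs.comp_add_right t₁).differentiableWithinAt_time (hsub hs) x₀)
      rw [e1]
      exact timeDerivWithin_comp_add_right (Ico 0 T) G t₁ s x₀
    rw [h2, h1]
  -- the growth hypothesis for the abstract device
  have hgrow : ∀ s ∈ Icc 0 L, 0 < s → ∀ (x₀ e₀ : EuclideanSpace ℝ (Fin 3)), ‖e₀‖ = 1 →
      (∀ (y e' : EuclideanSpace ℝ (Fin 3)), ‖e'‖ = 1 → ⟪W s y e', e'⟫ ≤ ⟪W s x₀ e₀, e₀⟫) →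
      B (s + t₁) < ⟪W s x₀ e₀, e₀⟫ →
      ⟪timeDerivWithin (Icc 0 L) W s x₀ e₀, e₀⟫ ≤ φ (s + t₁) * ⟪W s x₀ e₀, e₀⟫ := by
    intro s hs hspos x₀ e₀ he₀ hmax hbig
    rw [hkey s hs x₀ e₀]
    exact hrate (s + t₁) ⟨by linarith, (hmem s hs).2⟩ x₀ e₀ ⟨he₀, hmax⟩ hbig
  have hM : ∀ (y e' : EuclideanSpace ℝ (Fin 3)), ‖e'‖ = 1 → ⟪W 0 y e', e'⟫ ≤ B (0 + t₁) := by
    intro y e' he'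
    simp only [hW, hG, zero_add]
    exact hinit y e' he'
  have hmain := rayleigh_le_supersolution_of_argmax_growth (φ := fun s => φ (s + t₁)) hWs hunif hBc' hBpos'
    hBd' hsuper' hgrow hM (t - t₁) ⟨by linarith [ht.1], by rw [hLdef]; linarith [ht.2]⟩ x e he
  simp only [hW, hG, sub_add_cancel] at hmain
  exact hmain

end Summit.NavierStokesRegularity.NavierStokesRegularity.Theorems.ArgmaxDoors

end
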